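import Mathlib
import Summits.Ventures.PercRepro.TriangleCapThreeBelowTwoTrianglesA
import Summits.Ventures.PercRepro.TriangleCapThreeBelowTwoTrianglesB
import Summits.Ventures.PercRepro.TriangleCapThreeBelowThreeTrianglesF
import Summits.Ventures.PercRepro.TriangleCapThreeBelowOneTriangleD
import Summits.Ventures.PercRepro.TriangleCapThreeBelowOneTriangleA
import Summits.Ventures.PercRepro.TriangleCapThreeBelowOneTriangleB
import Summits.Ventures.PercRepro.TriangleCapTriangleFreeThreeD

/-!
# PercRepro — THREE BELOW THE DIAGONAL IS EXACT ON THE `K₄⁻`-FREE CLASS FOR EVERY `k ≥ 12` (p3, gen 38; part 106)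

**`dense_stability_three_of_twelve`**: a `K₄⁻`-free graph on `k ≥ 12` vertices with `2m ≥ 6k − 24` edges,
`2m ≠ 6k − 20`, that is not bipartite spanning with at most two missing cross pairs has
`Σ_v d(v)² + 3 (k − 4) ≤ m k` — by the number of triangles: none (`triangle_free_stability_three`, part 62);
one, by the outer vertices (`≥ 2`: `one_triangle_stability_three_of_outer`; one:
`one_triangle_stability_three_of_one_outer`; none: `one_triangle_stability_three_no_outer`, parts 96, 97, 105);
two (vertex-disjoint / sharing a vertex, parts 98, 99); three (the four intersection patterns, part 103); four or
more (`|T₃| ≥ 24`, `six_mul_card_le_card_triangles3`, and the envelope `stability_three_of_twentyfour` from `k = 12`).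
**`three_below_diagonal_exact_k4m_of_twelve`**: for `k ≥ 12`, `1 ≤ a`, `a + 3 ≤ k`, `m = a (k − a) − 3 ≥ 2k − 3`
with `m, m + 1, m + 2` not of the form `a′ (k − a′)`, the maximum of `2·Σ_v C(d(v), 2)` over the `K₄⁻`-free graphs
on `Fin k` with `m` edges IS `m (k − 2) − 3 (k − 4)`, attained by `K_{a, k−a}` minus three edges at one vertex — the
sub-diagonal `r = 3` of the closed form on the dense corner from `k = 12` on; the arithmetic of the cells
(`cell_arith_three`): `3 ≤ a ≤ k − 3` by the density, so `m ≥ 3k − 12`, and `m = 3k − 10` would need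
`(a − 3)(k − a − 3) = 2`, i.e. `k = 9`.  The cells `(12, 24) 108 · (12, 29) 133 · (13, 27) 135 · (13, 33) 168 ·
(14, 30) 165 · (14, 37) 207` by name.  The exclusion `2m ≠ 6k − 20` is necessary for the stability (not for the
cells): `K_{2, k−5}` between two private sets of a triangle is `K₄⁻`-free with `m = 3k − 10` and
`Σ_v d(v)² = mk − 3(k − 4) + 4`.  Axioms: standard.
-/

namespace PercRepro

namespace TriangleCap

namespace C047

open Finset

variable {V : Type*} [Fintype V] [DecidableEq V]

/-- **THE `r = 3` STABILITY OF THE DENSE CORNER FOR `k ≥ 12`:** `K₄⁻`-free, `2m ≥ 6k − 24`, `2m ≠ 6k − 20`, not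
bipartite spanning with at most two missing cross pairs ⇒ `Σ_v d(v)² + 3 (k − 4) ≤ m k`. -/
theorem dense_stability_three_of_twelve (D : SimpleGraph V) [DecidableRel D.Adj] (hK : K4mFree D)
    (hk : 12 ≤ Fintype.card V) (hm : 6 * Fintype.card V ≤ 2 * D.edgeFinset.card + 24)
    (hm' : 2 * D.edgeFinset.card + 20 ≠ 6 * Fintype.card V)
    (hnot : ¬ ∃ A : Finset V, (∀ x y, D.Adj x y → (x ∈ A ↔ y ∉ A)) ∧ (missing D A Aᶜ).card ≤ 2) :
    ∑ v, deg D v * deg D v + 3 * (Fintype.card V - 4) ≤ D.edgeFinset.card * Fintype.card V := by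
  have hm2 : 2 * Fintype.card V ≤ D.edgeFinset.card + 3 := by omega
  by_cases hfree : D.CliqueFree 3
  · exact triangle_free_stability_three D hfree hm2 hnot
  obtain ⟨S, hS⟩ := not_forall.mp hfree
  have hS' := not_not.mp hS
  rw [SimpleGraph.is3Clique_iff] at hS'
  obtain ⟨u, v, w, huv, huw, hvw, -⟩ := hS'
  by_cases hT : ∀ a b c, D.Adj a b → D.Adj a c → D.Adj b c → a = u ∨ a = v ∨ a = w
  · -- ONE TRIANGLE: by the number of outer vertices
    set Q : Finset V := (({u, v, w} : Finset V)ᶜ).filter (fun z => degIn D {u, v, w} z = 0) with hQ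
    rcases Nat.lt_or_ge Q.card 2 with hQ2 | hQ2
    · rcases Nat.eq_zero_or_pos Q.card with hQ0 | hQ1
      · -- no outer vertex
        have hq : ∀ z, z ∉ ({u, v, w} : Finset V) → 1 ≤ degIn D {u, v, w} z := by
          intro z hz
          by_contra h0
          have hzQ : z ∈ Q := by
            rw [hQ, mem_filter, mem_compl]
            exact ⟨hz, by omega⟩
          rw [card_eq_zero] at hQ0
          rw [hQ0] at hzQ
          exact notMem_empty z hzQ
        exact one_triangle_stability_three_no_outer D hK huv huw hvw hT hq (by omega) hm hm' (Or.inl hk)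
      · -- exactly one outer vertex
        have hQ1' : Q.card = 1 := by omega
        obtain ⟨z, hz⟩ := card_eq_one.mp hQ1'
        have hzQ : z ∈ Q := by rw [hz]; exact mem_singleton_self z
        rw [hQ, mem_filter, mem_compl] at hzQ
        have hq : ∀ y, y ∉ ({u, v, w} : Finset V) → y ≠ z → 1 ≤ degIn D {u, v, w} y := by
          intro y hy hyz
          by_contra h0
          have hyQ : y ∈ Q := by
            rw [hQ, mem_filter, mem_compl]
            exact ⟨hy, by omega⟩
          rw [hz, mem_singleton] at hyQ
          exact hyz hyQ
        exact one_triangle_stability_three_of_one_outer D hK huv huw hvw hT hzQ.1 hzQ.2 hq (by omega)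
    · exact one_triangle_stability_three_of_outer D hK huv huw hvw hT hm (by rw [← hQ]; omega)
  simp only [not_forall, not_or] at hT
  obtain ⟨a, b, c, hab, hac, hbc, hau, hav, haw⟩ := hT
  have ha : ¬ (a = u ∨ a = v ∨ a = w) := fun h => by
    rcases h with h | h | h
    · exact hau h
    · exact hav h
    · exact haw h
  by_cases hT3 : ∀ x y z, D.Adj x y → D.Adj x z → D.Adj y z → x = u ∨ x = v ∨ x = w ∨ x = a ∨ x = b ∨ x = c
  · -- TWO TRIANGLES
    by_cases hdisj : ∀ t, (t = u ∨ t = v ∨ t = w) → ¬ (t = a ∨ t = b ∨ t = c)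
    · exact two_triangles_stability_three_of_disjoint D hK (by omega) hm huv huw hvw hab hac hbc hT3 hdisj
    · simp only [not_forall, not_not, exists_prop] at hdisj
      obtain ⟨t, ht1, ht2⟩ := hdisj
      exact two_triangles_stability_three_of_shared D hK (by omega) hm huv huw hvw hab hac hbc ha hT3 ⟨ht1, ht2⟩
  simp only [not_forall, not_or] at hT3
  obtain ⟨x, y, z, hxy, hxz, hyz, hxu, hxv, hxw, hxa, hxb, hxc⟩ := hT3
  have hx : ¬ (x = u ∨ x = v ∨ x = w ∨ x = a ∨ x = b ∨ x = c) := fun h => by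
    rcases h with h | h | h | h | h | h
    · exact hxu h
    · exact hxv h
    · exact hxw h
    · exact hxa h
    · exact hxb h
    · exact hxc h
  set T₁ : Finset V := {u, v, w} with hT₁
  set T₂ : Finset V := {a, b, c} with hT₂
  set T₃ : Finset V := {x, y, z} with hT₃
  by_cases hT4 : ∀ x' y' z', D.Adj x' y' → D.Adj x' z' → D.Adj y' z' →
      (x' ∈ T₁ ∧ y' ∈ T₁) ∨ (x' ∈ T₂ ∧ y' ∈ T₂) ∨ (x' ∈ T₃ ∧ y' ∈ T₃)
  · -- THREE TRIANGLES
    exact three_triangles_stability_three_of_ten D hK (by omega) hm huv huw hvw hab hac hbc hxy hxz hyz ha hx hT4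
  -- FOUR TRIANGLES: `|T₃| ≥ 24` and the envelope
  have h₁ : T₁.card = 3 := card_triple huv.ne huw.ne hvw.ne
  have h₂ : T₂.card = 3 := card_triple hab.ne hac.ne hbc.ne
  have h₃ : T₃.card = 3 := card_triple hxy.ne hxz.ne hyz.ne
  have hx1 : ¬ (x = u ∨ x = v ∨ x = w) := fun h => hx (by tauto)
  have hx2 : ¬ (x = a ∨ x = b ∨ x = c) := fun h => hx (by tauto)
  have hi12 : (T₁ ∩ T₂).card ≤ 1 := inter_card_le_one_of_triangles D hK huv huw hvw hab hac hbc ha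
  have hi13 : (T₁ ∩ T₃).card ≤ 1 := inter_card_le_one_of_triangles D hK huv huw hvw hxy hxz hyz hx1
  have hi23 : (T₂ ∩ T₃).card ≤ 1 := inter_card_le_one_of_triangles D hK hab hac hbc hxy hxz hyz hx2
  simp only [not_forall, not_or] at hT4
  obtain ⟨x', y', z', hxy', hxz', hyz', h1, h2, h3⟩ := hT4
  set T₄ : Finset V := {x', y', z'} with hT₄
  have hx'4 : x' ∈ T₄ := by rw [hT₄]; exact mem_insert_self _ _
  have hy'4 : y' ∈ T₄ := by rw [hT₄]; exact mem_insert_of_mem (mem_insert_self _ _)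
  have hne1 : T₄ ≠ T₁ := fun h => h1 ⟨h ▸ hx'4, h ▸ hy'4⟩
  have hne2 : T₄ ≠ T₂ := fun h => h2 ⟨h ▸ hx'4, h ▸ hy'4⟩
  have hne3 : T₄ ≠ T₃ := fun h => h3 ⟨h ▸ hx'4, h ▸ hy'4⟩
  have hne12 : T₁ ≠ T₂ := fun h => by rw [h, inter_self, h₂] at hi12; omega
  have hne13 : T₁ ≠ T₃ := fun h => by rw [h, inter_self, h₃] at hi13; omega
  have hne23 : T₂ ≠ T₃ := fun h => by rw [h, inter_self, h₃] at hi23; omega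
  have hF : ({T₁, T₂, T₃, T₄} : Finset (Finset V)).card = 4 := by
    rw [card_insert_of_notMem, card_insert_of_notMem, card_insert_of_notMem, card_singleton]
    · rw [mem_singleton]; exact Ne.symm hne3
    · rw [mem_insert, mem_singleton, not_or]; exact ⟨hne23, Ne.symm hne2⟩
    · rw [mem_insert, mem_insert, mem_singleton, not_or, not_or]; exact ⟨hne12, hne13, Ne.symm hne1⟩
  have h24 := six_mul_card_le_card_triangles3 D {T₁, T₂, T₃, T₄} (by
    intro T hT
    simp only [mem_insert, mem_singleton] at hT
    rcases hT with rfl | rfl | rfl | rfl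
    · exact ⟨u, v, w, huv, huw, hvw, rfl⟩
    · exact ⟨a, b, c, hab, hac, hbc, rfl⟩
    · exact ⟨x, y, z, hxy, hxz, hyz, rfl⟩
    · exact ⟨x', y', z', hxy', hxz', hyz', rfl⟩)
  rw [hF] at h24
  exact stability_three_of_twentyfour D hK hk h24

omit [Fintype V] [DecidableEq V] in
/-- The arithmetic of the cells three below the diagonal: `2k ≤ a (k − a)` with `a ≤ k` forces `3 ≤ a ≤ k − 3`, so
`a (k − a) ≥ 3 (k − 3)`; and `a (k − a) = 3k − 7` forces `k = 9`. -/
theorem cell_arith_three (k a : ℕ) (hak : a ≤ k) (hdense : 2 * k ≤ a * (k - a)) (hk : 12 ≤ k) :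
    3 * (k - 3) ≤ a * (k - a) ∧ a * (k - a) ≠ 3 * k - 7 := by
  have ha3 : 3 ≤ a := by
    by_contra h
    push Not at h
    interval_cases a <;> omega
  have hak3 : a + 3 ≤ k := by
    by_contra h
    push Not at h
    obtain ⟨d, hd⟩ : ∃ d, k = a + d := ⟨k - a, by omega⟩
    subst hd
    have : a + d - a = d := by omega
    rw [this] at hdense
    have hd2 : d ≤ 2 := by omega
    interval_cases d <;> omega
  obtain ⟨p, hp⟩ : ∃ p, a = p + 3 := ⟨a - 3, by omega⟩
  obtain ⟨q, hq⟩ : ∃ q, k = a + q + 3 := ⟨k - a - 3, by omega⟩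
  subst hp
  subst hq
  have e1 : p + 3 + q + 3 - (p + 3) = q + 3 := by omega
  have e2 : p + 3 + q + 3 - 3 = p + q + 3 := by omega
  rw [e1, e2]
  constructor
  · nlinarith
  · intro h
    have e3 : (p + 3) * (q + 3) = p * q + 3 * p + 3 * q + 9 := by ring
    rw [e3] at h
    have hpq : p * q = 2 := by omega
    have hp2 : p ≤ 2 := by
      by_contra hp3
      push Not at hp3
      have : 3 * q ≤ p * q := Nat.mul_le_mul_right q hp3
      have hq1 : 1 ≤ q := by
        by_contra hq0
        push Not at hq0
        interval_cases q
        omega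
      omega
    interval_cases p <;> omega

/-- **THREE BELOW THE DIAGONAL IS EXACT ON THE `K₄⁻`-FREE CLASS FOR EVERY `k ≥ 12`:** for `1 ≤ a`, `a + 3 ≤ k`,
`m = a (k − a) − 3 ≥ 2k − 3` with `m`, `m + 1`, `m + 2` not of the form `a′ (k − a′)`, the maximum of
`2·Σ_v C(d(v), 2)` over the `K₄⁻`-free graphs on `Fin k` with `m` edges is `m (k − 2) − 3 (k − 4)`, attained by
`K_{a, k−a}` minus three edges at one vertex. -/
theorem three_below_diagonal_exact_k4m_of_twelve (k a : ℕ) (hk : 12 ≤ k) (ha : 1 ≤ a) (hak : a + 3 ≤ k)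
    (hdense : 2 * k ≤ a * (k - a) - 3 + 3)
    (hm : ∀ a', a' ≤ k → a * (k - a) - 3 ≠ a' * (k - a') ∧ a * (k - a) - 2 ≠ a' * (k - a') ∧
      a * (k - a) - 1 ≠ a' * (k - a')) :
    (∀ (D : SimpleGraph (Fin k)) [DecidableRel D.Adj], K4mFree D →
        D.edgeFinset.card = a * (k - a) - 3 →
        2 * cherries D + 3 * (k - 4) ≤ (a * (k - a) - 3) * (k - 2)) ∧
      ∃ (D : SimpleGraph (Fin k)) (_ : DecidableRel D.Adj), K4mFree D ∧
        D.edgeFinset.card = a * (k - a) - 3 ∧ 2 * cherries D + 3 * (k - 4) = (a * (k - a) - 3) * (k - 2) := by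
  have hka : 3 ≤ a * (k - a) := by
    obtain ⟨c, hc⟩ : ∃ c, k = a + 3 + c := ⟨k - a - 3, by omega⟩
    subst hc
    have : a + 3 + c - a = 3 + c := by omega
    rw [this]
    nlinarith
  obtain ⟨hcell1, hcell2⟩ := cell_arith_three k a (by omega) (by omega) hk
  obtain ⟨m, hmm⟩ : ∃ m, a * (k - a) = m + 3 := ⟨a * (k - a) - 3, by omega⟩
  have e1 : a * (k - a) - 3 = m := by omega
  have e2 : a * (k - a) - 2 = m + 1 := by omega
  have e3 : a * (k - a) - 1 = m + 2 := by omega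
  rw [e1] at hdense hm ⊢
  rw [e2, e3] at hm
  rw [hmm] at hcell1 hcell2
  constructor
  · intro D _ hK hD
    have hcard : Fintype.card (Fin k) = k := Fintype.card_fin k
    have hnot : ¬ ∃ A : Finset (Fin k), (∀ x y, D.Adj x y → (x ∈ A ↔ y ∉ A)) ∧ (missing D A Aᶜ).card ≤ 2 := by
      rintro ⟨A, hA, hN⟩
      have hNX := card_missing_add_card_edges D A hA
      have hXc : Aᶜ.card = k - A.card := by
        have := card_add_card_compl A
        rw [hcard] at this
        omega
      have hXk : A.card ≤ k := by
        have := card_le_univ A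
        rwa [hcard] at this
      obtain ⟨h1, h2, h3⟩ := hm A.card hXk
      rw [hXc, hD] at hNX
      have : (missing D A Aᶜ).card = 0 ∨ (missing D A Aᶜ).card = 1 ∨ (missing D A Aᶜ).card = 2 := by omega
      rcases this with h | h | h
      · rw [h] at hNX; exact h1 (by omega)
      · rw [h] at hNX; exact h2 (by omega)
      · rw [h] at hNX; exact h3 (by omega)
    have h1 := dense_stability_three_of_twelve D hK (by rw [hcard]; exact hk) (by rw [hcard, hD]; omega)
      (by rw [hcard, hD]; omega) hnot
    have h2 := two_mul_cherries_add D
    have h3 := sum_deg_eq D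
    rw [hcard, hD] at h1
    rw [hD] at h3
    obtain ⟨k', hk'⟩ : ∃ k', k = k' + 4 := ⟨k - 4, by omega⟩
    subst hk'
    have e4 : k' + 4 - 4 = k' := by omega
    have e5 : k' + 4 - 2 = k' + 2 := by omega
    rw [e4] at h1 ⊢
    rw [e5]
    nlinarith
  · refine ⟨bipMinusStar k a 3, inferInstance, k4mFree_bipMinusStar k a 3, ?_, ?_⟩
    · have := card_edges_bipMinusStar k a 3 ha hak
      omega
    · have h := two_mul_cherries_bipMinusStar k a 3 ha hak (by omega)
      rw [hmm] at h
      obtain ⟨k', hk'⟩ : ∃ k', k = k' + 4 := ⟨k - 4, by omega⟩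
      subst hk'
      have e4 : k' + 4 - 4 = k' := by omega
      have e5 : k' + 4 - 2 = k' + 2 := by omega
      have e6 : 2 * (k' + 4) - 3 - 3 = 2 * k' + 2 := by omega
      rw [e5, e6] at h
      rw [e4, e5]
      nlinarith

/-- The cell `(12, 24)` on `K₄⁻`-free graphs (`24 = 3·9 − 3`; `24, 25, 26` are not products `a′(12 − a′)`):
`2·cherries ≤ 216`, attained. -/
theorem cell_twelve_twentyfour_k4m :
    (∀ (D : SimpleGraph (Fin 12)) [DecidableRel D.Adj], K4mFree D → D.edgeFinset.card = 24 →
      2 * cherries D ≤ 216) ∧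
    ∃ (D : SimpleGraph (Fin 12)) (_ : DecidableRel D.Adj), K4mFree D ∧ D.edgeFinset.card = 24 ∧
      2 * cherries D = 216 := by
  have h := three_below_diagonal_exact_k4m_of_twelve 12 3 (by norm_num) (by norm_num) (by norm_num) (by norm_num)
    (by decide)
  have e1 : 3 * (12 - 3) - 3 = 24 := by norm_num
  have e2 : (3 * (12 - 3) - 3) * (12 - 2) = 240 := by norm_num
  have e3 : 3 * (12 - 4) = 24 := by norm_num
  rw [e1, e2, e3] at h
  obtain ⟨h1, D, inst, h2, h3, h4⟩ := h
  exact ⟨fun D _ hK hD => by have := h1 D hK hD; omega, D, inst, h2, h3, by omega⟩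

/-- The cell `(12, 29)` on `K₄⁻`-free graphs (`29 = 4·8 − 3`; `29, 30, 31` are not products `a′(12 − a′)`):
`2·cherries ≤ 266`, attained. -/
theorem cell_twelve_twentynine_k4m :
    (∀ (D : SimpleGraph (Fin 12)) [DecidableRel D.Adj], K4mFree D → D.edgeFinset.card = 29 →
      2 * cherries D ≤ 266) ∧
    ∃ (D : SimpleGraph (Fin 12)) (_ : DecidableRel D.Adj), K4mFree D ∧ D.edgeFinset.card = 29 ∧
      2 * cherries D = 266 := by
  have h := three_below_diagonal_exact_k4m_of_twelve 12 4 (by norm_num) (by norm_num) (by norm_num) (by norm_num)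
    (by decide)
  have e1 : 4 * (12 - 4) - 3 = 29 := by norm_num
  have e2 : (4 * (12 - 4) - 3) * (12 - 2) = 290 := by norm_num
  have e3 : 3 * (12 - 4) = 24 := by norm_num
  rw [e1, e2, e3] at h
  obtain ⟨h1, D, inst, h2, h3, h4⟩ := h
  exact ⟨fun D _ hK hD => by have := h1 D hK hD; omega, D, inst, h2, h3, by omega⟩

/-- The cell `(13, 27)` on `K₄⁻`-free graphs (`27 = 3·10 − 3`; `27, 28, 29` are not products `a′(13 − a′)`):
`2·cherries ≤ 270`, attained. -/
theorem cell_thirteen_twentyseven_k4m :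
    (∀ (D : SimpleGraph (Fin 13)) [DecidableRel D.Adj], K4mFree D → D.edgeFinset.card = 27 →
      2 * cherries D ≤ 270) ∧
    ∃ (D : SimpleGraph (Fin 13)) (_ : DecidableRel D.Adj), K4mFree D ∧ D.edgeFinset.card = 27 ∧
      2 * cherries D = 270 := by
  have h := three_below_diagonal_exact_k4m_of_twelve 13 3 (by norm_num) (by norm_num) (by norm_num) (by norm_num)
    (by decide)
  have e1 : 3 * (13 - 3) - 3 = 27 := by norm_num
  have e2 : (3 * (13 - 3) - 3) * (13 - 2) = 297 := by norm_num
  have e3 : 3 * (13 - 4) = 27 := by norm_num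
  rw [e1, e2, e3] at h
  obtain ⟨h1, D, inst, h2, h3, h4⟩ := h
  exact ⟨fun D _ hK hD => by have := h1 D hK hD; omega, D, inst, h2, h3, by omega⟩

/-- The cell `(13, 33)` on `K₄⁻`-free graphs (`33 = 4·9 − 3`; `33, 34, 35` are not products `a′(13 − a′)`):
`2·cherries ≤ 336`, attained. -/
theorem cell_thirteen_thirtythree_k4m :
    (∀ (D : SimpleGraph (Fin 13)) [DecidableRel D.Adj], K4mFree D → D.edgeFinset.card = 33 →
      2 * cherries D ≤ 336) ∧
    ∃ (D : SimpleGraph (Fin 13)) (_ : DecidableRel D.Adj), K4mFree D ∧ D.edgeFinset.card = 33 ∧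
      2 * cherries D = 336 := by
  have h := three_below_diagonal_exact_k4m_of_twelve 13 4 (by norm_num) (by norm_num) (by norm_num) (by norm_num)
    (by decide)
  have e1 : 4 * (13 - 4) - 3 = 33 := by norm_num
  have e2 : (4 * (13 - 4) - 3) * (13 - 2) = 363 := by norm_num
  have e3 : 3 * (13 - 4) = 27 := by norm_num
  rw [e1, e2, e3] at h
  obtain ⟨h1, D, inst, h2, h3, h4⟩ := h
  exact ⟨fun D _ hK hD => by have := h1 D hK hD; omega, D, inst, h2, h3, by omega⟩

/-- The cell `(14, 30)` on `K₄⁻`-free graphs (`30 = 3·11 − 3`; `30, 31, 32` are not products `a′(14 − a′)`):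
`2·cherries ≤ 330`, attained. -/
theorem cell_fourteen_thirty_k4m :
    (∀ (D : SimpleGraph (Fin 14)) [DecidableRel D.Adj], K4mFree D → D.edgeFinset.card = 30 →
      2 * cherries D ≤ 330) ∧
    ∃ (D : SimpleGraph (Fin 14)) (_ : DecidableRel D.Adj), K4mFree D ∧ D.edgeFinset.card = 30 ∧
      2 * cherries D = 330 := by
  have h := three_below_diagonal_exact_k4m_of_twelve 14 3 (by norm_num) (by norm_num) (by norm_num) (by norm_num)
    (by decide)
  have e1 : 3 * (14 - 3) - 3 = 30 := by norm_num
  have e2 : (3 * (14 - 3) - 3) * (14 - 2) = 360 := by norm_num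
  have e3 : 3 * (14 - 4) = 30 := by norm_num
  rw [e1, e2, e3] at h
  obtain ⟨h1, D, inst, h2, h3, h4⟩ := h
  exact ⟨fun D _ hK hD => by have := h1 D hK hD; omega, D, inst, h2, h3, by omega⟩

/-- The cell `(14, 37)` on `K₄⁻`-free graphs (`37 = 4·10 − 3`; `37, 38, 39` are not products `a′(14 − a′)`):
`2·cherries ≤ 414`, attained. -/
theorem cell_fourteen_thirtyseven_k4m :
    (∀ (D : SimpleGraph (Fin 14)) [DecidableRel D.Adj], K4mFree D → D.edgeFinset.card = 37 →
      2 * cherries D ≤ 414) ∧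
    ∃ (D : SimpleGraph (Fin 14)) (_ : DecidableRel D.Adj), K4mFree D ∧ D.edgeFinset.card = 37 ∧
      2 * cherries D = 414 := by
  have h := three_below_diagonal_exact_k4m_of_twelve 14 4 (by norm_num) (by norm_num) (by norm_num) (by norm_num)
    (by decide)
  have e1 : 4 * (14 - 4) - 3 = 37 := by norm_num
  have e2 : (4 * (14 - 4) - 3) * (14 - 2) = 444 := by norm_num
  have e3 : 3 * (14 - 4) = 30 := by norm_num
  rw [e1, e2, e3] at h
  obtain ⟨h1, D, inst, h2, h3, h4⟩ := h
  exact ⟨fun D _ hK hD => by have := h1 D hK hD; omega, D, inst, h2, h3, by omega⟩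

end C047

end TriangleCap

end PercRepro
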